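import Literature.NumberTheory.DiophantineGeometry.FunctionFieldResidues
import Literature.NumberTheory.DiophantineGeometry.FunctionFieldDivisorClasses
import Literature.NumberTheory.DiophantineGeometry.FunctionFieldDivisorsResidueMap
import HarnessLib

/-!
# Ray classes modulo a power of a place and the number of positive divisors in a ray class
(Rosen Ch. 9 / Stichtenoth Lemma 5.1.4 with a modulus)

Let `F/K` be an algebraic function field of one variable with full constant field `K`, `P` a place
and `N ≥ 1`. The **ray** modulo `P^N` is the multiplicative group of functions
`h ≡ 1 (mod 𝔪_P^N)`, i.e. `v_P(h - 1) ≥ N` (`PlaceOver.ray`); two divisors are **ray equivalent**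
modulo `P^N` if they differ by the divisor of a ray function (`RayEquiv`). This file proves the
analogue "with modulus" of Stichtenoth's Lemma 5.1.4 (b)/(c) (the count of positive divisors in a
divisor class), which is the key input for the polynomiality of the `L`-series of a ray class
character (sibling file `FunctionFieldRayClassLSeries`), as in the classical proof that Hecke
`L`-functions of function fields with nontrivial "geometric" character are polynomials
(F. K. Schmidt 1931 / Hasse 1934 / Weil; Rosen, *Number Theory in Function Fields*, Ch. 9,
Thm. 9.16–9.24 context; M. Rosen gives the ideal-theoretic version):

* `PlaceOver.ray`, `mem_ray_iff`, group properties (`one_mem_ray`, `mul_mem_ray`, `inv_mem_ray`),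
  `valuation_eq_one_of_mem_ray` (ray functions are units at `P`), `algebraMap_eq_one_of_smul_mem_ray`
  (a constant multiple of a ray function is a ray function only for the constant `1`);
* `RayEquiv K P N D E` and its equivalence-relation properties;
* `nonnegRayEquivEquiv`: for `N ≥ 1`, the positive divisors ray-equivalent to `E` are in bijection
  with `ℒ(E) ∩ ray` via `h ↦ E + (h)` (injective because `ℒ(0) = K` and the only constant in the
  ray is `1`);
* `mem_riemannRochSpace_and_mem_ray_iff`: if `E(P) = 0` and `h₀ ∈ ℒ(E) ∩ ray`, then
  `ℒ(E) ∩ ray = h₀ + ℒ(E - N·P)`; hence `|ℒ(E) ∩ ray| = q^{ℓ(E - N·P)}` over `K = 𝔽_q`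
  (`natCard_riemannRochSpace_inter_ray`);
* `exists_mem_riemannRochSpace_mem_ray`: if moreover `deg(E - N·P) ≥ 2g - 1` then `ℒ(E) ∩ ray ≠ ∅`
  (successive approximation: the residue maps `ℒ(E - M·P) → F_P`, `0 ≤ M < N`, are onto by the
  Riemann–Roch theorem, Thm. 1.5.17);
* **`natCard_nonneg_rayEquiv`**: for `N ≥ 1`, `E(P) = 0`, `deg E - N deg P ≥ 2g - 1`, the number of
  positive divisors ray-equivalent to `E` modulo `P^N` is `q^{deg E - N deg P + 1 - g}` — in
  particular it depends only on `deg E`.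

Everything is proved; no named facts. The tree supplies places, divisors, `ℒ(D)`, `ℓ`, the genus,
the Riemann–Roch theorem (`ell_eq_degree_add_one_sub_genus`), `ℒ(0) = K`
(`exists_eq_algebraMap_of_principalDivisor_eq_zero`), the balls `P.ball n = π_Pⁿ𝒪_P` and the
residue maps `PlaceOver.evalMap` (`FunctionFieldDivisors*`, `FunctionFieldGenus*`,
`FunctionFieldAdelesProofs`, `FunctionFieldResidues`, `FunctionFieldDivisorsResidueMap`).

## References

* M. Rosen, *Number Theory in Function Fields*, GTM 210, Springer 2002, Ch. 9 (ray classes,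
  `L`-series of ray class characters). [RosenFunctionFields2002]
* H. Stichtenoth, *Algebraic Function Fields and Codes*, 2nd ed., GTM 254, Springer 2009,
  Lemma 1.4.8, Thm. 1.5.17, Lemma 5.1.4. [Stichtenoth2009]
-/

noncomputable section

open scoped Classical

namespace Literature.NumberTheory.DiophantineGeometry.AlgFunctionField

universe u v

variable {K : Type u} {F : Type v} [Field K] [Field F] [Algebra K F]

/-! ### The ray modulo `P^N` -/

namespace PlaceOver

/-- The **ray modulo `P^N`**: the functions `h ∈ F` with `h ≡ 1 (mod 𝔪_P^N)`, i.e.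
`h - 1 ∈ π_P^N 𝒪_P` (`v_P(h - 1) ≥ N`; Rosen Ch. 9, the subgroup `P_𝔪` of principal divisors of
functions `≡ 1 mod 𝔪`, here for the modulus `𝔪 = N·P`). For `N = 0` this is just `𝒪_P ∋ h - 1`.
[cite: RosenFunctionFields2002, Ch. 9] -/
def ray (P : PlaceOver K F) (N : ℕ) : Set F :=
  {h | h - 1 ∈ P.ball N}

variable {P : PlaceOver K F} {N : ℕ} {h h' : F}

/-- Membership in the ray: `v_P(h - 1) ≤ v_P(π_P)^N`. [folklore] -/
theorem mem_ray_iff (P : PlaceOver K F) (N : ℕ) (h : F) :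
    h ∈ P.ray N ↔ P.valuation (h - 1) ≤ P.valuation (P.uniformizer : F) ^ (N : ℤ) :=
  Iff.rfl

/-- `h ∈ ray ↔ h - 1 ∈ P.ball N`. [folklore] -/
theorem mem_ray_iff_sub_one_mem_ball (P : PlaceOver K F) (N : ℕ) (h : F) :
    h ∈ P.ray N ↔ h - 1 ∈ P.ball N :=
  Iff.rfl

/-- `1` is in every ray. [folklore] -/
theorem one_mem_ray (P : PlaceOver K F) (N : ℕ) : (1 : F) ∈ P.ray N := by
  rw [mem_ray_iff, sub_self, Valuation.map_zero]
  exact zero_le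

/-- For `N ≥ 1`, `v_P(π_P)^N < 1`. [folklore] -/
theorem valuation_uniformizer_zpow_lt_one (P : PlaceOver K F) (hN : 1 ≤ N) :
    P.valuation (P.uniformizer : F) ^ (N : ℤ) < 1 := by
  calc P.valuation (P.uniformizer : F) ^ (N : ℤ)
      ≤ P.valuation (P.uniformizer : F) ^ (1 : ℤ) :=
        P.zpow_valuation_uniformizer_le_of_le (by exact_mod_cast hN)
    _ = P.valuation (P.uniformizer : F) := zpow_one _
    _ < 1 := P.valuation_uniformizer_lt_one

/-- For `N ≥ 1`, a ray function `h` has `v_P(h - 1) < 1`. [folklore] -/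
theorem valuation_sub_one_lt_one_of_mem_ray (hN : 1 ≤ N) (hh : h ∈ P.ray N) :
    P.valuation (h - 1) < 1 :=
  lt_of_le_of_lt hh (P.valuation_uniformizer_zpow_lt_one hN)

/-- For `N ≥ 1`, ray functions are units at `P`: `v_P(h) = 1`. [folklore] -/
theorem valuation_eq_one_of_mem_ray (hN : 1 ≤ N) (hh : h ∈ P.ray N) : P.valuation h = 1 := by
  have hlt := valuation_sub_one_lt_one_of_mem_ray hN hh
  have : h = 1 + (h - 1) := by ring
  rw [this, Valuation.map_add_eq_of_lt_left]
  · exact Valuation.map_one _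
  · rwa [Valuation.map_one]

/-- For `N ≥ 1`, ray functions are nonzero. [folklore] -/
theorem ne_zero_of_mem_ray (hN : 1 ≤ N) (hh : h ∈ P.ray N) : h ≠ 0 := by
  rintro rfl
  have := valuation_eq_one_of_mem_ray hN hh
  rw [Valuation.map_zero] at this
  exact zero_ne_one this

/-- The ray is closed under multiplication (`hh' - 1 = h(h' - 1) + (h - 1)`). [folklore] -/
theorem mul_mem_ray (hN : 1 ≤ N) (hh : h ∈ P.ray N) (hh' : h' ∈ P.ray N) : h * h' ∈ P.ray N := by
  rw [mem_ray_iff] at hh hh' ⊢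
  have : h * h' - 1 = h * (h' - 1) + (h - 1) := by ring
  rw [this]
  refine (Valuation.map_add _ _ _).trans (max_le ?_ hh)
  rw [Valuation.map_mul, valuation_eq_one_of_mem_ray hN hh, one_mul]
  exact hh'

/-- The ray is closed under inversion (`h⁻¹ - 1 = -h⁻¹(h - 1)`). [folklore] -/
theorem inv_mem_ray (hN : 1 ≤ N) (hh : h ∈ P.ray N) : h⁻¹ ∈ P.ray N := by
  have h0 := ne_zero_of_mem_ray hN hh
  have h1 := valuation_eq_one_of_mem_ray hN hh
  rw [mem_ray_iff] at hh ⊢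
  have : h⁻¹ - 1 = -(h⁻¹ * (h - 1)) := by field_simp; ring
  rw [this, Valuation.map_neg, Valuation.map_mul, map_inv₀, h1, inv_one, one_mul]
  exact hh

/-- The ray shrinks as `N` grows. [folklore] -/
theorem ray_mono (P : PlaceOver K F) [IsAlgFunctionField K F] {M N : ℕ} (hMN : M ≤ N) :
    P.ray N ⊆ P.ray M := fun _ hh =>
  P.ball_antitone (by exact_mod_cast hMN) hh

/-- For `N ≥ 1`, ray functions have order `0` at `P`. [folklore] -/
theorem ord_eq_zero_of_mem_ray [IsAlgFunctionField K F] (hN : 1 ≤ N) (hh : h ∈ P.ray N) :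
    P.ord h = 0 := by
  have h0 := ne_zero_of_mem_ray hN hh
  have h1 := valuation_eq_one_of_mem_ray hN hh
  rw [P.valuation_eq_zpow_ord h0, ← zpow_zero (P.valuation (P.uniformizer : F))] at h1
  exact (zpow_right_strictAnti₀ P.valuation_uniformizer_pos P.valuation_uniformizer_lt_one).injective
    h1

/-- Ray functions have order `0` at `P`, hence their divisors vanish at `P`. [folklore] -/
theorem principalDivisor_apply_eq_zero_of_mem_ray [IsAlgFunctionField K F] (hN : 1 ≤ N)
    (hh : h ∈ P.ray N) : principalDivisor K h P = 0 := by
  rw [principalDivisor_apply_of_ne_zero (ne_zero_of_mem_ray hN hh), ord_eq_zero_of_mem_ray hN hh]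

/-- **The only constant multiple of a ray function that is a ray function is the function itself**
(`N ≥ 1`): if `h'` and `c • h'` (`c ∈ K`) both lie in the ray then `c = 1`. Indeed
`(c - 1) h' = (c h' - 1) - (h' - 1)` has `v_P < 1` while `v_P(h') = 1`, so the constant `c - 1` has
`v_P(c - 1) < 1`, i.e. `c = 1`. [folklore] -/
theorem algebraMap_eq_one_of_smul_mem_ray (hN : 1 ≤ N) (hh' : h' ∈ P.ray N) {c : K}
    (hc : algebraMap K F c * h' ∈ P.ray N) : c = 1 := by
  by_contra hc1
  have hne : c - 1 ≠ 0 := sub_ne_zero.2 hc1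
  have hval : P.valuation (algebraMap K F (c - 1)) = 1 :=
    IsAlgFunctionField.valuation_algebraMap_eq_one P.toValuationSubring P.algebraMap_mem hne
  have hlt1 := valuation_sub_one_lt_one_of_mem_ray hN hh'
  have hlt2 := valuation_sub_one_lt_one_of_mem_ray hN hc
  have h1 := valuation_eq_one_of_mem_ray hN hh'
  have key : algebraMap K F (c - 1) * h' = (algebraMap K F c * h' - 1) - (h' - 1) := by
    rw [map_sub, map_one]; ring
  have : P.valuation (algebraMap K F (c - 1) * h') < 1 := by
    rw [key]
    exact lt_of_le_of_lt (Valuation.map_sub _ _ _) (max_lt hlt2 hlt1)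
  rw [Valuation.map_mul, hval, h1, one_mul] at this
  exact lt_irrefl _ this

end PlaceOver

/-! ### Ray equivalence of divisors -/

variable (K) in
/-- **Ray equivalence modulo `P^N`**: `D ∼_{P^N} E` iff `D = E + (h)` for a nonzero ray function
`h ≡ 1 (mod 𝔪_P^N)` (Rosen Ch. 9: the ray class group `Cl_𝔪 = 𝒟_𝔪 / P_𝔪`; for `N ≥ 1` the
divisor `(h)` is automatically prime to `P`). [cite: RosenFunctionFields2002, Ch. 9] -/
def RayEquiv (P : PlaceOver K F) (N : ℕ) (D E : Divisor K F) : Prop :=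
  ∃ h : F, h ∈ P.ray N ∧ h ≠ 0 ∧ D = E + principalDivisor K h

namespace RayEquiv

variable [IsAlgFunctionField K F] {P : PlaceOver K F} {N : ℕ} {D E E' : Divisor K F}

/-- Ray equivalence is reflexive (`h = 1`). [folklore] -/
theorem refl (D : Divisor K F) : RayEquiv K P N D D :=
  ⟨1, P.one_mem_ray N, one_ne_zero, by rw [principalDivisor_one, add_zero]⟩

/-- Ray equivalence is symmetric for `N ≥ 1` (`h ↦ h⁻¹`). [folklore] -/
theorem symm (hN : 1 ≤ N) (hDE : RayEquiv K P N D E) : RayEquiv K P N E D := by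
  obtain ⟨h, hh, h0, rfl⟩ := hDE
  exact ⟨h⁻¹, PlaceOver.inv_mem_ray hN hh, inv_ne_zero h0,
    by rw [principalDivisor_inv h0]; abel⟩

/-- Ray equivalence is transitive for `N ≥ 1` (`h, h' ↦ h h'`). [folklore] -/
theorem trans (hN : 1 ≤ N) (h₁ : RayEquiv K P N D E) (h₂ : RayEquiv K P N E E') :
    RayEquiv K P N D E' := by
  obtain ⟨h, hh, h0, rfl⟩ := h₁
  obtain ⟨h', hh', h0', rfl⟩ := h₂
  exact ⟨h' * h, PlaceOver.mul_mem_ray hN hh' hh, mul_ne_zero h0' h0,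
    by rw [principalDivisor_mul h0' h0]; abel⟩

omit [IsAlgFunctionField K F] in
/-- Ray equivalence is invariant under translation. [folklore] -/
theorem add_right (hDE : RayEquiv K P N D E) (D₁ : Divisor K F) :
    RayEquiv K P N (D + D₁) (E + D₁) := by
  obtain ⟨h, hh, h0, rfl⟩ := hDE
  exact ⟨h, hh, h0, by abel⟩

omit [IsAlgFunctionField K F] in
/-- `D - D₁ ∼ E ↔ D ∼ E + D₁`. [folklore] -/
theorem sub_left_iff (D E D₁ : Divisor K F) :
    RayEquiv K P N (D - D₁) E ↔ RayEquiv K P N D (E + D₁) := by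
  constructor
  · intro h
    simpa using h.add_right D₁
  · intro h
    simpa [sub_eq_add_neg] using h.add_right (-D₁)

/-- Ray equivalent divisors have the same degree. [folklore] -/
theorem degree_eq (hDE : RayEquiv K P N D E) : D.degree = E.degree := by
  obtain ⟨h, -, h0, rfl⟩ := hDE
  rw [map_add, degree_principalDivisor_eq_zero h0, add_zero]

/-- For `N ≥ 1`, ray equivalent divisors have the same coefficient at `P`. [folklore] -/
theorem apply_eq (hN : 1 ≤ N) (hDE : RayEquiv K P N D E) : D P = E P := by
  obtain ⟨h, hh, -, rfl⟩ := hDE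
  rw [Finsupp.add_apply, PlaceOver.principalDivisor_apply_eq_zero_of_mem_ray hN hh, add_zero]

end RayEquiv

/-! ### Positive divisors in a ray class and `ℒ(E) ∩ ray` -/

section Count

variable [IsAlgFunctionField K F] {P : PlaceOver K F} {N : ℕ}

/-- For `0 ≠ h ∈ ℒ(E)`, the divisor `E + (h)` is positive. [cite: Stichtenoth2009, Remark 1.4.5(a)] -/
theorem nonneg_add_principalDivisor_of_mem' {E : Divisor K F} {h : F} (hh : h ∈ riemannRochSpace E)
    (h0 : h ≠ 0) : 0 ≤ E + principalDivisor K h := by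
  rw [add_comm]
  exact (mem_riemannRochSpace_iff_nonneg E h0).1 hh

/-- **The positive divisors ray-equivalent to `E` modulo `P^N` (`N ≥ 1`) are in bijection with
`ℒ(E) ∩ ray`**, via `h ↦ E + (h)` (Stichtenoth Lemma 5.1.4 (b) with a modulus: `E + (h) ≥ 0` iff
`h ∈ ℒ(E)`; `E + (h) = E + (h')` iff `h = c h'` with `c ∈ K^×` (`ℒ(0) = K`), and then `c = 1`
since `h, h'` are both `≡ 1 (mod 𝔪_P^N)`). [cite: Stichtenoth2009, Lemma 5.1.4(b)] -/
def nonnegRayEquivEquiv [IsIntegrallyClosedIn K F] (hN : 1 ≤ N) (E : Divisor K F) :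
    {h : F // h ∈ riemannRochSpace E ∧ h ∈ P.ray N} ≃
      {D : Divisor K F // 0 ≤ D ∧ RayEquiv K P N D E} :=
  Equiv.ofBijective
    (fun h => ⟨E + principalDivisor K (h : F),
      nonneg_add_principalDivisor_of_mem' h.2.1 (PlaceOver.ne_zero_of_mem_ray hN h.2.2),
      ⟨h, h.2.2, PlaceOver.ne_zero_of_mem_ray hN h.2.2, rfl⟩⟩)
    (by
      constructor
      · rintro ⟨h, hhL, hh⟩ ⟨h', hh'L, hh'⟩ heq
        have h0 := PlaceOver.ne_zero_of_mem_ray hN hh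
        have h0' := PlaceOver.ne_zero_of_mem_ray hN hh'
        have h1 : principalDivisor K h = principalDivisor K h' := by
          simpa using congrArg Subtype.val heq
        have h2 : principalDivisor K (h * h'⁻¹) = 0 := by
          rw [principalDivisor_mul h0 (inv_ne_zero h0'), principalDivisor_inv h0', h1, add_neg_cancel]
        obtain ⟨c, -, hc⟩ := exists_eq_algebraMap_of_principalDivisor_eq_zero
          (mul_ne_zero h0 (inv_ne_zero h0')) h2
        have hc' : algebraMap K F c * h' = h := by
          rw [hc, inv_mul_cancel_right₀ h0']
        have hc1 : c = 1 := PlaceOver.algebraMap_eq_one_of_smul_mem_ray hN hh' (by rwa [hc'])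
        apply Subtype.ext
        change h = h'
        rw [← hc', hc1, map_one, one_mul]
      · rintro ⟨D, hD, h, hh, h0, rfl⟩
        refine ⟨⟨h, ?_, hh⟩, rfl⟩
        rw [mem_riemannRochSpace_iff_nonneg E h0, add_comm]
        exact hD)

/-- Unfolding of `nonnegRayEquivEquiv`. [folklore] -/
theorem coe_nonnegRayEquivEquiv [IsIntegrallyClosedIn K F] (hN : 1 ≤ N) (E : Divisor K F)
    (h : {h : F // h ∈ riemannRochSpace E ∧ h ∈ P.ray N}) :
    ((nonnegRayEquivEquiv hN E h : {D : Divisor K F // 0 ≤ D ∧ RayEquiv K P N D E}) : Divisor K F) =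
      E + principalDivisor K (h : F) :=
  rfl

/-- Hence the two counts agree. [cite: Stichtenoth2009, Lemma 5.1.4(b)] -/
theorem natCard_nonneg_rayEquiv_eq [IsIntegrallyClosedIn K F] (hN : 1 ≤ N) (E : Divisor K F) :
    Nat.card {D : Divisor K F // 0 ≤ D ∧ RayEquiv K P N D E} =
      Nat.card {h : F // h ∈ riemannRochSpace E ∧ h ∈ P.ray N} :=
  (Nat.card_congr (nonnegRayEquivEquiv hN E)).symm

omit [IsAlgFunctionField K F] in
/-- Membership in `ℒ(E - N·P)` at a divisor with `E(P) = 0`: `z ∈ ℒ(E - N·P)` iff `z ∈ ℒ(E)` and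
`z ∈ π_P^N 𝒪_P`. [folklore] -/
theorem mem_riemannRochSpace_sub_single_iff {E : Divisor K F} (hE : E P = 0) (z : F) :
    z ∈ riemannRochSpace (E - Finsupp.single P (N : ℤ)) ↔ z ∈ riemannRochSpace E ∧ z ∈ P.ball N := by
  have hP : -((E - Finsupp.single P (N : ℤ)) P) = (N : ℤ) := by
    rw [Finsupp.sub_apply, Finsupp.single_eq_same, hE, zero_sub, neg_neg]
  have hQ : ∀ v : PlaceOver K F, v ≠ P → (E - Finsupp.single P (N : ℤ)) v = E v := fun v hv => by
    rw [Finsupp.sub_apply, Finsupp.single_apply, if_neg (fun h => hv h.symm), sub_zero]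
  simp only [mem_riemannRochSpace_iff, PlaceOver.mem_ball_iff]
  constructor
  · intro hz
    refine ⟨fun v => ?_, ?_⟩
    · by_cases hv : v = P
      · rw [hv]
        refine ((hP ▸ hz P)).trans ?_
        rw [hE, neg_zero]
        exact P.zpow_valuation_uniformizer_le_of_le (by exact_mod_cast N.zero_le)
      · rw [← hQ v hv]
        exact hz v
    · exact hP ▸ hz P
  · rintro ⟨hz, hzP⟩ v
    by_cases hv : v = P
    · rw [hv, hP]
      exact hzP
    · rw [hQ v hv]
      exact hz v

omit [IsAlgFunctionField K F] in
/-- **`ℒ(E) ∩ ray = h₀ + ℒ(E - N·P)`** for any `h₀ ∈ ℒ(E) ∩ ray`, when `E(P) = 0` and `N ≥ 1`: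
membership in `ℒ(E) ∩ ray` is "`h ∈ ℒ(E)` and `h - 1 ∈ π^N𝒪_P`", and both conditions are affine
with direction `ℒ(E) ∩ π^N𝒪_P = ℒ(E - N·P)`. [folklore] -/
theorem mem_riemannRochSpace_and_mem_ray_iff (hN : 1 ≤ N) {E : Divisor K F} (hE : E P = 0)
    {h₀ : F} (h₀L : h₀ ∈ riemannRochSpace E) (h₀r : h₀ ∈ P.ray N) (h : F) :
    (h ∈ riemannRochSpace E ∧ h ∈ P.ray N) ↔
      h - h₀ ∈ riemannRochSpace (E - Finsupp.single P (N : ℤ)) := by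
  have _ := hN
  rw [mem_riemannRochSpace_sub_single_iff hE, PlaceOver.mem_ray_iff_sub_one_mem_ball]
  rw [PlaceOver.mem_ray_iff_sub_one_mem_ball] at h₀r
  constructor
  · rintro ⟨hL, hr⟩
    refine ⟨Submodule.sub_mem _ hL h₀L, ?_⟩
    have : h - h₀ = (h - 1) - (h₀ - 1) := by ring
    rw [this]
    exact Submodule.sub_mem _ hr h₀r
  · rintro ⟨hL, hb⟩
    refine ⟨?_, ?_⟩
    · have : h = (h - h₀) + h₀ := by ring
      rw [this]
      exact Submodule.add_mem _ hL h₀L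
    · have : h - 1 = (h - h₀) + (h₀ - 1) := by ring
      rw [this]
      exact Submodule.add_mem _ hb h₀r

/-- The translation `h ↦ h - h₀` identifies `ℒ(E) ∩ ray` with `ℒ(E - N·P)`. [folklore] -/
def riemannRochSpaceInterRayEquiv (hN : 1 ≤ N) {E : Divisor K F} (hE : E P = 0)
    {h₀ : F} (h₀L : h₀ ∈ riemannRochSpace E) (h₀r : h₀ ∈ P.ray N) :
    {h : F // h ∈ riemannRochSpace E ∧ h ∈ P.ray N} ≃
      riemannRochSpace (E - Finsupp.single P (N : ℤ)) where
  toFun h := ⟨(h : F) - h₀, (mem_riemannRochSpace_and_mem_ray_iff hN hE h₀L h₀r _).1 h.2⟩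
  invFun z := ⟨(z : F) + h₀, (mem_riemannRochSpace_and_mem_ray_iff hN hE h₀L h₀r _).2
    (by simp)⟩
  left_inv h := by ext; simp
  right_inv z := by ext; simp

/-- **`|ℒ(E) ∩ ray| = q^{ℓ(E - N·P)}`** over a finite constant field, as soon as `ℒ(E) ∩ ray` is
nonempty (`E(P) = 0`, `N ≥ 1`). [folklore] -/
theorem natCard_riemannRochSpace_inter_ray [Finite K] (hN : 1 ≤ N) {E : Divisor K F}
    (hE : E P = 0) {h₀ : F} (h₀L : h₀ ∈ riemannRochSpace E) (h₀r : h₀ ∈ P.ray N) :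
    Nat.card {h : F // h ∈ riemannRochSpace E ∧ h ∈ P.ray N} =
      Nat.card K ^ ell (E - Finsupp.single P (N : ℤ)) := by
  haveI := finiteDimensional_riemannRochSpace_of_isAlgFunctionField (K := K)
    (E - Finsupp.single P (N : ℤ))
  rw [Nat.card_congr (riemannRochSpaceInterRayEquiv hN hE h₀L h₀r), ell,
    Module.natCard_eq_pow_finrank (K := K)]

/-! ### Nonemptiness of `ℒ(E) ∩ ray` by successive approximation (Riemann–Roch) -/

/-- **The residue map `ℒ(D + P) → F_P` is onto when `deg D > 2g - 2`**: by the Riemann–Roch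
theorem (Stichtenoth Thm. 1.5.17) `ℓ(D + P) - ℓ(D) = deg P = dim_K F_P`, and the kernel of the
residue map is `ℒ(D)` (Lemma 1.4.8). [cite: Stichtenoth2009, Thm. 1.5.17 and Lemma 1.4.8] -/
theorem evalMap_surjective_of_lt_degree [IsIntegrallyClosedIn K F] (P : PlaceOver K F)
    (D : Divisor K F) (hD : 2 * (genus K F : ℤ) - 2 < D.degree) :
    Function.Surjective (P.evalMap D) := by
  haveI := finiteDimensional_riemannRochSpace_of_isAlgFunctionField (K := K)
    (D + Finsupp.single P 1)
  haveI : FiniteDimensional K P.residueField := PlaceOver.finiteDimensional_residueField_holds P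
  rw [← LinearMap.range_eq_top]
  apply Submodule.eq_top_of_finrank_eq
  have hrk := (P.evalMap D).finrank_range_add_finrank_ker
  rw [(P.kerEvalMapEquiv D).finrank_eq] at hrk
  have hPd : (0 : ℤ) ≤ P.degree := Nat.cast_nonneg _
  have h1 := ell_eq_degree_add_one_sub_genus (K := K) (F := F) (A := D + Finsupp.single P 1)
    (by rw [degree_add_single]; omega)
  have h2 := ell_eq_degree_add_one_sub_genus (K := K) (F := F) (A := D) hD
  rw [degree_add_single] at h1
  unfold ell at h1 h2
  have hrk' := congrArg (Nat.cast : ℕ → ℤ) hrk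
  push_cast at hrk'
  have key : (Module.finrank K (LinearMap.range (P.evalMap D)) : ℤ) = P.degree := by omega
  unfold PlaceOver.degree at key
  exact_mod_cast key

/-- **`ℒ(E) ∩ ray ≠ ∅` when `E(P) = 0` and `deg E - N deg P > 2g - 2`** (successive approximation:
from `h₀ ∈ ℒ(E)` with `h₀ ≡ 1 (mod 𝔪_P^M)`, `M < N`, correct by `z ∈ ℒ(E - M·P)` with prescribed
residue of `z π_P^{-M}`, using that the residue map `ℒ(E - M·P) → F_P` is onto,
`evalMap_surjective_of_lt_degree`). [cite: Stichtenoth2009, Thm. 1.5.17 and Lemma 1.4.8] -/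
theorem exists_mem_riemannRochSpace_mem_ray [IsIntegrallyClosedIn K F] {E : Divisor K F}
    (hE : E P = 0) (hdeg : 2 * (genus K F : ℤ) - 2 < E.degree - N * P.degree) :
    ∃ h : F, h ∈ riemannRochSpace E ∧ h ∈ P.ray N := by
  suffices H : ∀ M : ℕ, M ≤ N → ∃ h : F, h ∈ riemannRochSpace E ∧ h ∈ P.ray M from H N le_rfl
  intro M
  induction M with
  | zero =>
    intro _
    refine ⟨0, Submodule.zero_mem _, ?_⟩
    rw [PlaceOver.mem_ray_iff_sub_one_mem_ball, zero_sub, Nat.cast_zero, PlaceOver.mem_ball_zero_iff]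
    exact neg_mem (one_mem _)
  | succ M ih =>
    intro hM
    obtain ⟨h₀, h₀L, h₀r⟩ := ih (Nat.le_of_succ_le hM)
    have h₀b : h₀ - 1 ∈ P.ball (M : ℤ) := h₀r
    set D' : Divisor K F := E - Finsupp.single P ((M : ℤ) + 1) with hD'
    have hD'P : D' P + 1 = -(M : ℤ) := by
      rw [hD', Finsupp.sub_apply, Finsupp.single_eq_same, hE]; ring
    have hD'1 : D' + Finsupp.single P 1 = E - Finsupp.single P (M : ℤ) := by
      rw [hD', sub_add, ← Finsupp.single_sub, add_sub_cancel_right]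
    have hdegD' : 2 * (genus K F : ℤ) - 2 < D'.degree := by
      rw [hD', map_sub, Divisor.degree_single]
      have hPd : (0 : ℤ) ≤ P.degree := Nat.cast_nonneg _
      have hMN : ((M : ℤ) + 1) ≤ N := by exact_mod_cast hM
      nlinarith
    obtain ⟨z, hz⟩ := evalMap_surjective_of_lt_degree P D' hdegD'
      (-(IsLocalRing.residue P.toValuationSubring
          ⟨(h₀ - 1) * (P.uniformizer : F) ^ (-(M : ℤ)), P.mul_uniformizer_zpow_neg_mem M h₀b⟩))
    have hz2 : (z : F) ∈ riemannRochSpace (E - Finsupp.single P (M : ℤ)) := hD'1 ▸ z.2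
    rw [mem_riemannRochSpace_sub_single_iff hE] at hz2
    obtain ⟨hzE, hzb⟩ := hz2
    refine ⟨h₀ + z, Submodule.add_mem _ h₀L hzE, ?_⟩
    rw [PlaceOver.mem_ray_iff_sub_one_mem_ball]
    have hw : h₀ + z - 1 = (h₀ - 1) + z := by ring
    have hwb : (h₀ - 1) + (z : F) ∈ P.ball (M : ℤ) := Submodule.add_mem _ h₀b hzb
    rw [hw, Nat.cast_succ, ← P.ballEval_eq_zero_iff (M : ℤ) ⟨_, hwb⟩]
    have hsplit : (⟨(h₀ - 1) + (z : F), hwb⟩ : P.ball (M : ℤ)) = ⟨h₀ - 1, h₀b⟩ + ⟨(z : F), hzb⟩ := rfl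
    rw [hsplit, map_add]
    have hzeval : P.ballEval (M : ℤ) ⟨(z : F), hzb⟩ = P.evalMap D' z := by
      rw [PlaceOver.evalMap_apply]
      change IsLocalRing.residue P.toValuationSubring _ = _
      congr 1
      apply Subtype.ext
      change (z : F) * (P.uniformizer : F) ^ (-(M : ℤ)) = (z : F) * (P.uniformizer : F) ^ (D' P + 1)
      rw [hD'P]
    rw [hzeval, hz]
    exact add_neg_cancel _

/-- **The number of positive divisors in a ray class** (Stichtenoth Lemma 5.1.4 (b)/(c) with a
modulus; Rosen Ch. 9): for `N ≥ 1`, `E(P) = 0` and `deg E - N deg P > 2g - 2`, the positive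
divisors ray-equivalent to `E` modulo `P^N` number `q^{ℓ(E - N·P)}`. [cite: Stichtenoth2009, Lemma 5.1.4] -/
theorem natCard_nonneg_rayEquiv [Finite K] [IsIntegrallyClosedIn K F] (hN : 1 ≤ N)
    {E : Divisor K F} (hE : E P = 0) (hdeg : 2 * (genus K F : ℤ) - 2 < E.degree - N * P.degree) :
    Nat.card {D : Divisor K F // 0 ≤ D ∧ RayEquiv K P N D E} =
      Nat.card K ^ ell (E - Finsupp.single P (N : ℤ)) := by
  obtain ⟨h₀, h₀L, h₀r⟩ := exists_mem_riemannRochSpace_mem_ray (P := P) hE hdeg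
  rw [natCard_nonneg_rayEquiv_eq hN, natCard_riemannRochSpace_inter_ray hN hE h₀L h₀r]

/-- The exponent: `ℓ(E - N·P) = deg E - N deg P + 1 - g` when `deg E - N deg P > 2g - 2`
(Stichtenoth Thm. 1.5.17). [cite: Stichtenoth2009, Thm. 1.5.17] -/
theorem ell_sub_single_eq [IsIntegrallyClosedIn K F] {E : Divisor K F}
    (hdeg : 2 * (genus K F : ℤ) - 2 < E.degree - N * P.degree) :
    (ell (E - Finsupp.single P (N : ℤ)) : ℤ) = E.degree - N * P.degree + 1 - genus K F := by
  have h := ell_eq_degree_add_one_sub_genus (K := K) (F := F) (A := E - Finsupp.single P (N : ℤ))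
    (by rw [map_sub, Divisor.degree_single]; exact hdeg)
  rw [map_sub, Divisor.degree_single] at h
  exact h

/-- **The number of positive divisors in a ray class depends only on the degree**: for `N ≥ 1`,
`E(P) = E'(P) = 0`, `deg E = deg E' > 2g - 2 + N deg P`, the ray classes of `E` and `E'` contain the
same number of positive divisors. [cite: Stichtenoth2009, Lemma 5.1.4] -/
theorem natCard_nonneg_rayEquiv_eq_of_degree_eq [Finite K] [IsIntegrallyClosedIn K F] (hN : 1 ≤ N)
    {E E' : Divisor K F} (hE : E P = 0) (hE' : E' P = 0) (hEE' : E.degree = E'.degree)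
    (hdeg : 2 * (genus K F : ℤ) - 2 < E.degree - N * P.degree) :
    Nat.card {D : Divisor K F // 0 ≤ D ∧ RayEquiv K P N D E} =
      Nat.card {D : Divisor K F // 0 ≤ D ∧ RayEquiv K P N D E'} := by
  rw [natCard_nonneg_rayEquiv hN hE hdeg, natCard_nonneg_rayEquiv hN hE' (hEE' ▸ hdeg)]
  congr 1
  have h1 := ell_sub_single_eq (P := P) (N := N) hdeg
  have h2 := ell_sub_single_eq (P := P) (N := N) (hEE' ▸ hdeg)
  rw [← hEE'] at h2
  exact_mod_cast h1.trans h2.symm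

/-- In particular a ray class of large degree contains a positive divisor: the count is positive.
[cite: Stichtenoth2009, Lemma 5.1.4] -/
theorem natCard_nonneg_rayEquiv_pos [Finite K] [IsIntegrallyClosedIn K F] (hN : 1 ≤ N)
    {E : Divisor K F} (hE : E P = 0) (hdeg : 2 * (genus K F : ℤ) - 2 < E.degree - N * P.degree) :
    0 < Nat.card {D : Divisor K F // 0 ≤ D ∧ RayEquiv K P N D E} := by
  rw [natCard_nonneg_rayEquiv hN hE hdeg]
  exact pow_pos Nat.card_pos _

end Count

end Literature.NumberTheory.DiophantineGeometry.AlgFunctionField
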